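import Summits.PneNP.PneNP.Theorems.ChebyshevTracialDesignBlockDiagonal
import Summits.PneNP.PneNP.Theorems.ChebyshevTracialDesignCommutative
import HarnessLib

/-!
# Cell pnp-psdrank, route `ChebyshevTracialDesign`: ONE-SIDED block structure suffices — pinching the matching side along the cut side's blocks
# (crux `TracialDecayExp20`, stmt-PneNP-19878)

Brick 39 (prover g9). The tree's `…BlockDiagonal` reduces a tight psd rectangle that is block-diagonal on BOTH sides to its blocks, and `…Commutative` /
brick 34's `value_div_le_of_cutEigenbasis` show that for blocks of size 1 the CUT side alone decides. The same is true for blocks of any size: if every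
`X_U` is block-diagonal for a labelling `blk : Fin r → Fin m` of the coordinates and `Y` is ARBITRARY, PINCH the matching side,
`Y'_M[i,j] = Y_M[i,j]·1[blk i = blk j]`. Then (§1) `Y'_M = Σ_b Π_b Y_M Π_b` with the block projections `Π_b`, so `0 ⪯ Y'_M ⪯ I`; (§2) tightness survives,
`X_U Y'_M = Σ_b Π_b (X_U Y_M) Π_b = 0`, because `X_U` commutes with every `Π_b`; and the value is unchanged, `tr(X_U Y'_M) = tr(X_U Y_M)`
(`isPsdRect_pinch`, `trace_mul_pinch`). Hence every bound for two-sided block-diagonal strategies holds for one-sided ones (`value_le_of_cutBlockDiagonal`,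
`value_div_le_of_cutBlocks_le`): the crux's dimension budget may be replaced by the largest block of the CUT side alone, whatever the matching side does (and,
after a common rotation `O`, for cut sides that are simultaneously block-diagonalisable: `value_div_le_of_cutBlocks_conj`). [cite: Rothvoss2017, §2 (PDF pp. 6–7)]
[cite: BrietDadushPokutta2014, Thm. 6 (§3)]
Stature: support/instrument. WHAT THIS IS NOT: nothing on strategies without block structure, nothing on psd rank, no P-vs-NP content.
-/

set_option linter.dupNamespace false -- `Summit.PneNP.PneNP.…`: summit = sub-problem (D-0017)

noncomputable section

namespace Summit.PneNP.PneNP.Theorems.ChebyshevTracialDesignOneSidedBlocks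

open scoped Classical

open Finset Matrix Literature.Barriers.PneNP Literature.Combinatorics.Optimization
open Summit.PneNP.PneNP.Theorems.ChebyshevTracialDesignBlockDiagonal (value_le_of_blockDiagonal value_div_le_of_blocks_le)
open Summit.PneNP.PneNP.Theorems.ChebyshevTracialDesignCommutative (isPsdRect_conj value_conj)

variable {n r m : ℕ}

/-! ### §1 Block projections and pinching -/

/-- The pinching of `Y` along `blk` is the sum of its block compressions: `Σ_b Π_b Y Π_b`, `Π_b = diag(1[blk = b])`. -/
theorem pinch_eq_sum_compressions (blk : Fin r → Fin m) (Y : Matrix (Fin r) (Fin r) ℝ) :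
    (Matrix.of fun i j => if blk i = blk j then Y i j else 0) =
      ∑ b : Fin m, diagonal (fun i => if blk i = b then (1 : ℝ) else 0) * Y * diagonal (fun i => if blk i = b then (1 : ℝ) else 0) := by
  ext i j
  rw [Matrix.sum_apply, Matrix.of_apply]
  simp only [diagonal_mul, mul_diagonal]
  have e : ∀ b : Fin m, (if blk i = b then (1 : ℝ) else 0) * Y i j * (if blk j = b then (1 : ℝ) else 0) =
      if blk i = b then (if blk j = b then Y i j else 0) else 0 := fun b => by
    split_ifs <;> simp
  simp_rw [e]
  rw [Finset.sum_ite_eq, if_pos (mem_univ _)]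
  by_cases h : blk i = blk j
  · rw [if_pos h, if_pos h.symm]
  · rw [if_neg h, if_neg (fun h' => h h'.symm)]

/-- The block projections sum to the identity: `Σ_b Π_b 1 Π_b = 1`. -/
theorem sum_compressions_one (blk : Fin r → Fin m) :
    ∑ b : Fin m, diagonal (fun i => if blk i = b then (1 : ℝ) else 0) * (1 : Matrix (Fin r) (Fin r) ℝ) *
      diagonal (fun i => if blk i = b then (1 : ℝ) else 0) = 1 := by
  rw [← pinch_eq_sum_compressions blk 1]
  ext i j
  rw [Matrix.of_apply]
  by_cases h : i = j
  · subst h; simp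
  · rw [one_apply_ne h]; split_ifs <;> rfl

/-- Pinching preserves `0 ⪯ · ⪯ I`. -/
theorem pinch_contraction (blk : Fin r → Fin m) {Y : Matrix (Fin r) (Fin r) ℝ} (h0 : Y.PosSemidef) (h1 : (1 - Y).PosSemidef) :
    (Matrix.of fun i j => if blk i = blk j then Y i j else 0).PosSemidef ∧
      (1 - Matrix.of fun i j => if blk i = blk j then Y i j else 0).PosSemidef := by
  have hPb : ∀ b : Fin m, (diagonal (fun i => if blk i = b then (1 : ℝ) else 0))ᴴ = diagonal (fun i => if blk i = b then (1 : ℝ) else 0) :=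
    fun b => by rw [conjTranspose_eq_transpose_of_trivial, diagonal_transpose]
  have hcomp : ∀ (b : Fin m) {A : Matrix (Fin r) (Fin r) ℝ}, A.PosSemidef →
      (diagonal (fun i => if blk i = b then (1 : ℝ) else 0) * A * diagonal (fun i => if blk i = b then (1 : ℝ) else 0)).PosSemidef := by
    intro b A hA
    have h := hA.mul_mul_conjTranspose_same (diagonal (fun i => if blk i = b then (1 : ℝ) else 0))
    rwa [hPb b] at h
  refine ⟨?_, ?_⟩
  · rw [pinch_eq_sum_compressions]
    exact posSemidef_sum _ fun b _ => hcomp b h0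
  · have e : 1 - (Matrix.of fun i j => if blk i = blk j then Y i j else 0) =
        ∑ b : Fin m, diagonal (fun i => if blk i = b then (1 : ℝ) else 0) * (1 - Y) * diagonal (fun i => if blk i = b then (1 : ℝ) else 0) := by
      rw [pinch_eq_sum_compressions, ← sum_compressions_one blk, ← sum_sub_distrib, sum_compressions_one]
      refine sum_congr rfl fun b _ => ?_
      rw [Matrix.mul_sub, Matrix.sub_mul]
    rw [e]
    exact posSemidef_sum _ fun b _ => hcomp b h1

/-- A block-diagonal `X` commutes with every block projection: `X Π_b = Π_b X`. -/
theorem blockDiagonal_comm_proj (blk : Fin r → Fin m) {X : Matrix (Fin r) (Fin r) ℝ} (hX : ∀ i j, blk i ≠ blk j → X i j = 0) (b : Fin m) :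
    X * diagonal (fun i => if blk i = b then (1 : ℝ) else 0) = diagonal (fun i => if blk i = b then (1 : ℝ) else 0) * X := by
  ext i j
  rw [mul_diagonal, diagonal_mul]
  by_cases hij : blk i = blk j
  · rw [hij]; split_ifs <;> ring
  · rw [hX i j hij]; simp

/-! ### §2 Pinching the matching side keeps tightness and the value -/

/-- **Tightness survives pinching.** If `X_U` is block-diagonal and `X_U Y_M = 0`, then `X_U Y'_M = 0` for the pinched `Y'_M`. -/
theorem mul_pinch_eq_zero (blk : Fin r → Fin m) {X Y : Matrix (Fin r) (Fin r) ℝ} (hX : ∀ i j, blk i ≠ blk j → X i j = 0) (h : X * Y = 0) :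
    X * (Matrix.of fun i j => if blk i = blk j then Y i j else 0) = 0 := by
  rw [pinch_eq_sum_compressions, mul_sum]
  refine sum_eq_zero fun b _ => ?_
  calc X * (diagonal (fun i => if blk i = b then (1 : ℝ) else 0) * Y * diagonal (fun i => if blk i = b then (1 : ℝ) else 0))
      = (X * diagonal (fun i => if blk i = b then (1 : ℝ) else 0)) * Y * diagonal (fun i => if blk i = b then (1 : ℝ) else 0) := by
        simp only [Matrix.mul_assoc]
    _ = diagonal (fun i => if blk i = b then (1 : ℝ) else 0) * (X * Y) * diagonal (fun i => if blk i = b then (1 : ℝ) else 0) := by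
        rw [blockDiagonal_comm_proj blk hX b]; simp only [Matrix.mul_assoc]
    _ = 0 := by rw [h, Matrix.mul_zero, Matrix.zero_mul]

/-- **The value survives pinching.** If `X` is block-diagonal then `tr(X Y') = tr(X Y)`. -/
theorem trace_mul_pinch (blk : Fin r → Fin m) {X : Matrix (Fin r) (Fin r) ℝ} (hX : ∀ i j, blk i ≠ blk j → X i j = 0) (Y : Matrix (Fin r) (Fin r) ℝ) :
    (X * Matrix.of fun i j => if blk i = blk j then Y i j else 0).trace = (X * Y).trace := by
  simp only [trace, diag_apply, mul_apply, Matrix.of_apply]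
  refine sum_congr rfl fun i _ => sum_congr rfl fun k _ => ?_
  by_cases h : blk k = blk i
  · rw [if_pos h]
  · rw [if_neg h, hX i k (fun h' => h h'.symm), zero_mul, zero_mul]

/-- **One-sided block structure gives a two-sided block-diagonal tight psd rectangle with the same value.** -/
theorem isPsdRect_pinch (blk : Fin r → Fin m) {X : OddSet n → Matrix (Fin r) (Fin r) ℝ} {Y : PMatch n → Matrix (Fin r) (Fin r) ℝ}
    (hXY : IsPsdRect X Y) (hX : ∀ U i j, blk i ≠ blk j → X U i j = 0) :
    IsPsdRect X (fun M => Matrix.of fun i j => if blk i = blk j then Y M i j else 0) ∧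
      (∀ M i j, blk i ≠ blk j → (Matrix.of fun i j => if blk i = blk j then Y M i j else 0) i j = 0) ∧
      ∀ (W : OddSet n → PMatch n → ℝ), ∑ U, ∑ M, W U M * (X U * Matrix.of fun i j => if blk i = blk j then Y M i j else 0).trace =
        ∑ U, ∑ M, W U M * (X U * Y M).trace := by
  refine ⟨⟨hXY.1, fun M => pinch_contraction blk (hXY.2.1 M).1 (hXY.2.1 M).2, fun U M hUM => mul_pinch_eq_zero blk (hX U) (hXY.2.2 U M hUM)⟩,
    fun M i j hij => by rw [Matrix.of_apply, if_neg hij], fun W => ?_⟩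
  exact sum_congr rfl fun U _ => sum_congr rfl fun M _ => by rw [trace_mul_pinch blk (hX U)]

/-! ### §3 Consequences: the cut side's blocks decide -/

/-- **One-sided block-diagonal strategies reduce to their blocks.** If `X` is block-diagonal for `blk` (the matching side `Y` arbitrary) and `W` has tracial
value `≤ γ` in the dimension of every block, then the value of the tight psd rectangle `(X, Y)` is `≤ r·γ`. [cite: Rothvoss2017, §2 (PDF pp. 6–7)] -/
theorem value_le_of_cutBlockDiagonal (blk : Fin r → Fin m) (W : OddSet n → PMatch n → ℝ) (γ : ℝ)
    (hγ : ∀ b : Fin m, TracialValueLEAt W γ (Fintype.card {i : Fin r // blk i = b}))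
    {X : OddSet n → Matrix (Fin r) (Fin r) ℝ} {Y : PMatch n → Matrix (Fin r) (Fin r) ℝ} (h : IsPsdRect X Y)
    (hX : ∀ U i j, blk i ≠ blk j → X U i j = 0) :
    ∑ U, ∑ M, W U M * (X U * Y M).trace ≤ r * γ := by
  obtain ⟨hP, hY', hval⟩ := isPsdRect_pinch blk h hX
  rw [← hval W]
  exact value_le_of_blockDiagonal blk W γ hγ hP hX hY'

/-- **The dimension budget can be replaced by the largest block of the CUT side.** If `TracialValueLEAt W γ d` holds for every `d ≤ d₀` and the cut side of
a tight psd rectangle of dimension `r ≥ 1` is block-diagonal with blocks of size `≤ d₀` (matching side arbitrary), then `value/r ≤ γ`.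
[cite: Rothvoss2017, §2 (PDF pp. 6–7)] -/
theorem value_div_le_of_cutBlocks_le (hr : 0 < r) (blk : Fin r → Fin m) (W : OddSet n → PMatch n → ℝ) (γ : ℝ) (d₀ : ℕ)
    (hγ : ∀ d : ℕ, d ≤ d₀ → TracialValueLEAt W γ d) (hsmall : ∀ b : Fin m, Fintype.card {i : Fin r // blk i = b} ≤ d₀)
    {X : OddSet n → Matrix (Fin r) (Fin r) ℝ} {Y : PMatch n → Matrix (Fin r) (Fin r) ℝ} (h : IsPsdRect X Y)
    (hX : ∀ U i j, blk i ≠ blk j → X U i j = 0) :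
    (∑ U, ∑ M, W U M * (X U * Y M).trace) / r ≤ γ := by
  obtain ⟨hP, hY', hval⟩ := isPsdRect_pinch blk h hX
  rw [← hval W]
  exact value_div_le_of_blocks_le hr blk W γ d₀ hγ hsmall hP hX hY'

/-- **After a common rotation.** If `Oᵀ O = I` and every `Oᵀ X_U O` is block-diagonal for `blk` with blocks of size `≤ d₀` (i.e. the cut operators are
simultaneously block-diagonalisable with small blocks), the matching side being arbitrary, then `value/r ≤ γ` as soon as `TracialValueLEAt W γ d` holds
for all `d ≤ d₀`. With `d₀ = 1` this is brick 34's `value_div_le_of_cutEigenbasis`. [cite: Rothvoss2017, §2 (PDF pp. 6–7)] -/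
theorem value_div_le_of_cutBlocks_conj (hr : 0 < r) (blk : Fin r → Fin m) (W : OddSet n → PMatch n → ℝ) (γ : ℝ) (d₀ : ℕ)
    (hγ : ∀ d : ℕ, d ≤ d₀ → TracialValueLEAt W γ d) (hsmall : ∀ b : Fin m, Fintype.card {i : Fin r // blk i = b} ≤ d₀)
    (O : Matrix (Fin r) (Fin r) ℝ) (hO : Oᵀ * O = 1)
    {X : OddSet n → Matrix (Fin r) (Fin r) ℝ} {Y : PMatch n → Matrix (Fin r) (Fin r) ℝ} (h : IsPsdRect X Y)
    (hX : ∀ U i j, blk i ≠ blk j → (Oᵀ * X U * O) i j = 0) :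
    (∑ U, ∑ M, W U M * (X U * Y M).trace) / r ≤ γ := by
  have hO' : O * Oᵀ = 1 := mul_eq_one_comm.1 hO
  have hOt : (Oᵀ)ᵀ * Oᵀ = 1 := by rw [transpose_transpose, hO']
  have hconj := isPsdRect_conj h Oᵀ hOt
  have hval := value_conj W X Y Oᵀ hOt
  rw [← hval]
  refine value_div_le_of_cutBlocks_le hr blk W γ d₀ hγ hsmall hconj fun U i j hij => ?_
  have := hX U i j hij
  rwa [transpose_transpose]

end Summit.PneNP.PneNP.Theorems.ChebyshevTracialDesignOneSidedBlocks

end
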